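import Literature.AnabelianGeometry.EtaleTheta.Discharge.Sec2LiftingSurjProofs
import Literature.AnabelianGeometry.EtaleTheta.Discharge.Sec2CyclotomicCharacterProofs
import Literature.AnabelianGeometry.EtaleTheta.Discharge.Sec2Prop214iiOfSetting

/-!
# [EtTh] Cor 2.18 (iv), surjectivity, for the §1 model: reduction to Cor 2.18 (i) and constant
# multiple rigidity (proof-only)

Mochizuki, *The Étale Theta Function …* [EtTh], Publ. RIMS 45 (2009), §2, Cor 2.18 (iv), PRIMS PDF
pp.61–63 (locators `p.N` = PDF pages; bib key `MochizukiEtTh2009`): "the surjectivity of the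
homomorphism of (iv) follows by applying the algorithm of (ii), in light of … (iii)". PROOF-ONLY;
seat abc-iut-L2-t10 (unit "deep EtTh:Prop2.14(ii)-model (hgal)", follow-up).

`Discharge/Sec2LiftingSurjProofs.lean` reduced `RigidData.Cor218_iv_surjective` to Cor 2.18 (i),
Cor 2.18 (ii), the `γ`-invariance `hχ` of the cyclotomic character and the collection stability
`hcoll` (constant multiple rigidity at level `N`, Cor 2.19 (iii)); `Discharge/Sec2CyclotomicCharacterProofs.lean`
derived `hχ` from Cor 2.18 (i). Here the two are combined (`cor218_iv_surjective_of_cor218_i_ii`,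
generic), and for abc-iut-L2-t8's §1 instantiation `rigidData` — where Cor 2.18 (ii) is now a theorem
conditional on Prop 1.5 (ii), (iii) (`rigidData_cor218_ii`, `Discharge/Sec2Prop214iiOfSetting.lean`) —
Cor 2.18 (iv)-surjectivity follows from Cor 2.18 (i) (the anabelian input, FACT-level) and `hcoll`
alone (`rigidData_cor218_iv_surjective`). HONEST FRAMING: kernel-checked reductions; the hypotheses
are not asserted; no side taken on [IUTchIII] Cor 3.12.
-/

noncomputable section

namespace Literature.AnabelianGeometry.EtaleTheta

universe u

namespace RigidData

variable {N : ℕ+} {l : ℕ} (R : RigidData.{u} N l)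

/-- **Cor 2.18 (iv), surjectivity ⟸ Cor 2.18 (i) ∧ Cor 2.18 (ii) ∧ constant multiple rigidity**: the
`γ`-invariance of the cyclotomic character required by `cor218_iv_surjective_of` follows from
Cor 2.18 (i) (`chi_aug_invariant`: `γ` preserves `Ker(Π^tp_X ↠ (Π^tp_X)^Θ)` and `l·Δ_Θ`).
[cite: MochizukiEtTh2009, Cor 2.18(iv) p.61] -/
theorem cor218_iv_surjective_of_cor218_i_ii (h218i : R.Cor218_i) (h218ii : R.Cor218_ii)
    (hcoll : ∀ γ : R.PiX ≃ₜ* R.PiX, R.PiY.map γ.toMulEquiv.toMonoidHom = R.PiY →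
      ∃ ψ : R.mu ≃* R.mu, ∀ (η : R.PiYdd → R.mu), η ∈ R.thetaCocycles →
        ∃ (η'' : R.PiYdd → R.mu) (_ : η'' ∈ R.thetaCocycles) (c : R.G → R.mu)
          (hc : CycEnvelope.IsEnvCocycle R.augY R.chi (c ∘ R.augY))
          (_ : CycEnvelope.shift hc ∈ contMulAut R.env),
          ∀ d d' : R.PiYdd, γ (d : R.PiX) = d' → ψ (η d) = η'' d' * c (R.augY (R.inclYdd d'))) :
    R.Cor218_iv_surjective :=
  R.cor218_iv_surjective_of h218i h218ii
    (fun γ _ x => R.chi_aug_invariant γ (h218i γ).2.2.2.1 (h218i γ).2.2.2.2.1 x) hcoll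

end RigidData

namespace ThetaSetting

namespace EtaleThetaData.DoubleUnderline

variable {p : ℕ} [Fact p.Prime] {D : ThetaSetting p} {E : D.EtaleThetaData} {l : ℕ}
  (C : E.DoubleUnderline l) {Es : Set ℕ+} (τ : D.CyclotomeTower l Es)

/-- **[EtTh] Cor 2.18 (iv), surjectivity, for the §1 model** at every level of a `CyclotomeTower`: for
abc-iut-L2-t8's `R = C.rigidData (τ.mod M) hC hS h15 L`, every automorphism `γ` of `Π^tp_X̲̲`
preserving `Π^tp_Y̲̲` lifts to an automorphism of the model mono-theta environment — conditional on
Cor 2.18 (i) for `R` (the anabelian input), the constant multiple rigidity `hcoll` at level `M`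
(Cor 2.19 (iii)), and t1's named facts Prop 1.5 (ii), (iii) (through `rigidData_cor218_ii`).
[cite: MochizukiEtTh2009, Cor 2.18(iv) p.61] -/
theorem rigidData_cor218_iv_surjective (M : Es) (hC : D.Compat) (hS : D.Sec2Hyps)
    (h15 : Prop15iii E hC) (h15ii : Prop15ii E.toKummerData hC) (L : C.CuspLabels)
    (R : RigidData.{0} M l) (hR : R = C.rigidData (τ.mod M) hC hS h15 L) (h218i : R.Cor218_i)
    (hcoll : ∀ γ : R.PiX ≃ₜ* R.PiX, R.PiY.map γ.toMulEquiv.toMonoidHom = R.PiY →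
      ∃ ψ : R.mu ≃* R.mu, ∀ (η : R.PiYdd → R.mu), η ∈ R.thetaCocycles →
        ∃ (η'' : R.PiYdd → R.mu) (_ : η'' ∈ R.thetaCocycles) (c : R.G → R.mu)
          (hc : CycEnvelope.IsEnvCocycle R.augY R.chi (c ∘ R.augY))
          (_ : CycEnvelope.shift hc ∈ contMulAut R.env),
          ∀ d d' : R.PiYdd, γ (d : R.PiX) = d' → ψ (η d) = η'' d' * c (R.augY (R.inclYdd d'))) :
    R.Cor218_iv_surjective := by
  subst hR
  exact RigidData.cor218_iv_surjective_of_cor218_i_ii _ h218i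
    (C.rigidData_cor218_ii τ M hC hS h15 h15ii L) hcoll

end EtaleThetaData.DoubleUnderline

end ThetaSetting

end Literature.AnabelianGeometry.EtaleTheta

end
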